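import Summits.FinalStateConjecture.FinalStateConjecture.Theorems.EIHFluxBalanceInertialRecessionVirialLemmaC
import Summits.FinalStateConjecture.FinalStateConjecture.Theorems.EIHFluxBalanceInertialRecessionVirialMotion
import Summits.FinalStateConjecture.FinalStateConjecture.Theorems.EIHFluxBalanceInertialRecessionVirialDynamics

/-!
# Route EIHFluxBalance — crux `InertialRecession`, abstract endgame: the whole system is COLD or LINEARLY EXTENDED FOREVER

Helper file for `stmt-FinalStateConjecture-10166` (virial route, `InertialRecession_endgame_generalN_virial.md` §7b(b)); Mathlib-only,
literal hypotheses of `stub_pairwiseDichotomy`. `tendsto_charges_univ`: the global window `(0, (κ+κ²)t/2)` (clearance `(1−κ)/2`, no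
outsiders) is admissible forever, so total energy and momentum converge. `cold_or_extended`: EITHER all velocities converge to ONE
vector (`K∞ = 0`, cold limit) OR `diam(t) ≥ b·t` at ALL late times (`K∞ > 0`: virial inequality for the root `univ` along a grid,
`|G| ≤ A·diam`, `σ₂ ≥ K∞/(2C_K)`, then `eventually_linear_of_grid`). So `diam/t` never dithers between `0` and a positive level.
-/

noncomputable section

open Finset Filter Topology MeasureTheory intervalIntegral

namespace Summit.FinalStateConjecture.FinalStateConjecture.Theorems.SublinearIsFree.Virial

open Literature.Geometry.Lorentzian

variable {N : ℕ}

/-- **The total charges converge**: the global window `(0, (κ+κ²)t/2)` with clearance `δ = (1−κ)/2` is an admissible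
`2`-Lipschitz path for all late `t` (members at `‖ξⱼ‖ ≤ κ²t ≤ (1−δ)R`, no outsiders), so `Σ Mⱼγⱼ → E∞`, `Σ Mⱼγⱼvⱼ → P∞`. [folklore] -/
theorem tendsto_charges_univ (M : Fin N → ℝ) (ξ v : Fin N → ℝ → E3) (κ : ℝ)
    (P : ℝ → E3 → ℝ → Fin 4 → ℝ) (hκ0 : 0 < κ) (hκ1 : κ < 1)
    (hcone : ∀ i, ∀ᶠ t in atTop, ‖ξ i t‖ ≤ κ ^ 2 * t)
    (hWL : ∀ ρ : ℝ → ℝ, Tendsto ρ atTop atTop → ∀ δ : ℝ, 0 < δ → δ < 1 → ∃ (C T : ℝ),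
      ∀ (t₁ t₂ : ℝ) (c : ℝ → E3) (R : ℝ → ℝ), T ≤ t₁ → t₁ ≤ t₂ →
      (∀ s ∈ Set.Icc t₁ t₂, ∀ s' ∈ Set.Icc t₁ t₂, ‖c s - c s'‖ ≤ 2 * |s - s'| ∧ |R s - R s'| ≤ 2 * |s - s'|) →
      (∀ s ∈ Set.Icc t₁ t₂, ρ s ≤ δ * R s ∧ ‖c s‖ + R s ≤ (κ + κ ^ 2) / 2 * s ∧
        ∀ j, ‖ξ j s - c s‖ ≤ (1 - δ) * R s ∨ (1 + δ) * R s ≤ ‖ξ j s - c s‖) →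
      ∀ μ : Fin 4, |P t₂ (c t₂) (R t₂) μ - P t₁ (c t₁) (R t₁) μ| ≤ C * ∫ s in t₁..t₂, (R s ^ (3 / 2 : ℝ))⁻¹)
    (hID : ∀ ρ : ℝ → ℝ, Tendsto ρ atTop atTop → ∀ δ : ℝ, 0 < δ → δ < 1 → ∃ (T : ℝ) (ζ : ℝ → ℝ),
      Tendsto ζ atTop (𝓝 0) ∧ ∀ (t : ℝ) (c : E3) (R : ℝ) (A : Finset (Fin N)), T ≤ t → ρ t ≤ δ * R →
      ‖c‖ + R ≤ (κ + κ ^ 2) / 2 * t → (∀ j, ‖ξ j t - c‖ ≤ (1 - δ) * R ∨ (1 + δ) * R ≤ ‖ξ j t - c‖) →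
      (∀ j, j ∈ A ↔ ‖ξ j t - c‖ ≤ (1 - δ) * R) →
      |P t c R 0 - ∑ j ∈ A, M j * (√(1 - ‖v j t‖ ^ 2))⁻¹| ≤ ζ t ∧
      ∀ k : Fin 3, |P t c R k.succ - ∑ j ∈ A, M j * (√(1 - ‖v j t‖ ^ 2))⁻¹ * v j t k| ≤ ζ t) :
    ∃ (Einf : ℝ) (Pinf : E3), Tendsto (fun t ↦ ∑ j, M j * (√(1 - ‖v j t‖ ^ 2))⁻¹) atTop (𝓝 Einf) ∧
      Tendsto (fun t ↦ ∑ j, (M j * (√(1 - ‖v j t‖ ^ 2))⁻¹) • v j t) atTop (𝓝 Pinf) := by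
  set c₀ : ℝ := (κ + κ ^ 2) / 2 with hc₀
  set δ : ℝ := (1 - κ) / 2 with hδ
  have hc₀pos : 0 < c₀ := by positivity
  have hc₀two : c₀ ≤ 2 := by rw [hc₀]; nlinarith
  obtain ⟨hδ0, hδ1⟩ : 0 < δ ∧ δ < 1 := ⟨by rw [hδ]; linarith, by rw [hδ]; linarith⟩
  have hfit : κ ^ 2 ≤ (1 - δ) * c₀ := by
    rw [hδ, hc₀]; nlinarith [sq_nonneg (1 - κ)]
  have hρ : Tendsto (fun t : ℝ ↦ √t) atTop atTop := by
    have := tendsto_rpow_atTop (show (0 : ℝ) < 1 / 2 by norm_num)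
    refine this.congr' ?_
    filter_upwards [eventually_ge_atTop 0] with t ht
    rw [Real.sqrt_eq_rpow]
  obtain ⟨C, T_W, hW⟩ := hWL (fun t ↦ √t) hρ δ hδ0 hδ1
  obtain ⟨T_I, ζ, hζ, hI⟩ := hID (fun t ↦ √t) hρ δ hδ0 hδ1
  have hev_sqrt : ∀ᶠ t : ℝ in atTop, √t ≤ δ * (c₀ * t) := by
    have hdc : 0 < δ * c₀ := mul_pos hδ0 hc₀pos
    filter_upwards [eventually_ge_atTop (1 / (δ * c₀) ^ 2), eventually_ge_atTop (0 : ℝ)] with t ht ht0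
    have hdc2 : 0 < (δ * c₀) ^ 2 := by positivity
    have ht' : 1 ≤ (δ * c₀) ^ 2 * t := by
      have := (div_le_iff₀ hdc2).mp ht
      linarith
    have hy : 0 ≤ δ * (c₀ * t) := by positivity
    have hle : t ≤ (δ * (c₀ * t)) ^ 2 := by nlinarith
    calc √t ≤ √((δ * (c₀ * t)) ^ 2) := Real.sqrt_le_sqrt hle
      _ = δ * (c₀ * t) := Real.sqrt_sq hy
  have hev_cone : ∀ᶠ t in atTop, ∀ i, ‖ξ i t‖ ≤ κ ^ 2 * t := eventually_all.mpr hcone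
  obtain ⟨T₀, hT₀⟩ := eventually_atTop.mp (hev_cone.and hev_sqrt)
  set T : ℝ := max (max (max T₀ T_W) T_I) 1 with hTdef
  have hT0 : T₀ ≤ T := ((le_max_left _ _).trans (le_max_left _ _)).trans (le_max_left _ _)
  have hTW : T_W ≤ T := ((le_max_right _ _).trans (le_max_left _ _)).trans (le_max_left _ _)
  have hTI : T_I ≤ T := (le_max_right _ _).trans (le_max_left _ _)
  have hT1 : 1 ≤ T := le_max_right _ _
  have hTpos : 0 < T := one_pos.trans_le hT1
  have hadm : ∀ t, T ≤ t → √t ≤ δ * (c₀ * t) ∧ ‖(0 : E3)‖ + c₀ * t ≤ (κ + κ ^ 2) / 2 * t ∧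
      ∀ j, ‖ξ j t - 0‖ ≤ (1 - δ) * (c₀ * t) ∨ (1 + δ) * (c₀ * t) ≤ ‖ξ j t - 0‖ := by
    intro t ht
    obtain ⟨hc, hs⟩ := hT₀ t (hT0.trans ht)
    have htpos : 0 < t := hTpos.trans_le ht
    refine ⟨hs, by rw [norm_zero, zero_add, hc₀], fun j ↦ Or.inl ?_⟩
    rw [sub_zero]
    calc ‖ξ j t‖ ≤ κ ^ 2 * t := hc j
      _ ≤ (1 - δ) * c₀ * t := mul_le_mul_of_nonneg_right hfit htpos.le
      _ = (1 - δ) * (c₀ * t) := by ring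
  set Q : ℝ → Fin 4 → ℝ := fun t μ ↦ P t 0 (c₀ * t) μ with hQ
  have hlaw : ∀ t₁ t₂, T ≤ t₁ → t₁ ≤ t₂ → ∀ μ, |Q t₂ μ - Q t₁ μ| ≤
      C * ∫ s in t₁..t₂, ((c₀ * s) ^ (3 / 2 : ℝ))⁻¹ := by
    intro t₁ t₂ ht₁ h12 μ
    refine hW t₁ t₂ (fun _ ↦ 0) (fun s ↦ c₀ * s) (hTW.trans ht₁) h12 (fun s hs s' hs' ↦ ⟨?_, ?_⟩) ?_ μ
    · simp
    · rw [← mul_sub, abs_mul, abs_of_pos hc₀pos]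
      exact mul_le_mul_of_nonneg_right hc₀two (abs_nonneg _)
    · intro s hs
      exact hadm s (ht₁.trans hs.1)
  have hconv : ∀ μ, ∃ L : ℝ, Tendsto (fun t ↦ Q t μ) atTop (𝓝 L) :=
    Endgame.exists_tendsto_charge_of_linear_scale (R := fun s ↦ c₀ * s) hTpos hc₀pos
      ((continuous_const.mul continuous_id).continuousOn) (fun s _ ↦ le_rfl) hlaw
  have hmem : ∀ t, T ≤ t → ∀ j, j ∈ (univ : Finset (Fin N)) ↔ ‖ξ j t - 0‖ ≤ (1 - δ) * (c₀ * t) := by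
    intro t ht j
    simp only [Finset.mem_univ, true_iff]
    rcases (hadm t ht).2.2 j with h | h
    · exact h
    · exfalso
      obtain ⟨hc, -⟩ := hT₀ t (hT0.trans ht)
      have htpos : 0 < t := hTpos.trans_le ht
      have h1 : ‖ξ j t - 0‖ ≤ (1 - δ) * (c₀ * t) := by
        rw [sub_zero]
        calc ‖ξ j t‖ ≤ κ ^ 2 * t := hc j
          _ ≤ (1 - δ) * c₀ * t := mul_le_mul_of_nonneg_right hfit htpos.le
          _ = (1 - δ) * (c₀ * t) := by ring
      have h2 : 0 < δ * (c₀ * t) := by positivity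
      nlinarith
  have hid : ∀ t, T ≤ t → |Q t 0 - ∑ j, M j * (√(1 - ‖v j t‖ ^ 2))⁻¹| ≤ ζ t ∧
      ∀ kk : Fin 3, |Q t kk.succ - ∑ j, M j * (√(1 - ‖v j t‖ ^ 2))⁻¹ * v j t kk| ≤ ζ t := by
    intro t ht
    obtain ⟨hs, hcone', hclear⟩ := hadm t ht
    have h := hI t 0 (c₀ * t) univ (hTI.trans ht) hs hcone' hclear (hmem t ht)
    simpa [hQ] using h
  choose L hL using hconv
  have hE : Tendsto (fun t ↦ ∑ j, M j * (√(1 - ‖v j t‖ ^ 2))⁻¹) atTop (𝓝 (L 0)) :=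
    Endgame.tendsto_of_abs_sub_le_of_tendsto (hL 0) hζ fun t ht ↦ (hid t ht).1
  have hPk : ∀ i : Fin 3, Tendsto (fun t ↦ ∑ j, M j * (√(1 - ‖v j t‖ ^ 2))⁻¹ * v j t i) atTop (𝓝 (L i.succ)) :=
    fun i ↦ Endgame.tendsto_of_abs_sub_le_of_tendsto (hL i.succ) hζ fun t ht ↦ (hid t ht).2 i
  let Pinf : E3 := WithLp.toLp 2 fun i ↦ L i.succ
  refine ⟨L 0, Pinf, hE, Endgame.tendsto_euclidean_of_forall_apply fun i ↦ ?_⟩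
  have h1 : (fun t ↦ (∑ j, (M j * (√(1 - ‖v j t‖ ^ 2))⁻¹) • v j t) i) =
      fun t ↦ ∑ j, M j * (√(1 - ‖v j t‖ ^ 2))⁻¹ * v j t i := by
    ext t
    simp only [WithLp.ofLp_sum, Finset.sum_apply, PiLp.smul_apply, smul_eq_mul]
  rw [h1]
  simpa [Pinf] using hPk i

/-- **One body has no internal energy**: `Mγ − √(M² + ‖Mγv‖²) = 0`. [folklore] -/
theorem internalEnergy_singleton {M : ℝ} (hM : 0 < M) {u : E3} (hu : ‖u‖ < 1) :
    M * (√(1 - ‖u‖ ^ 2))⁻¹ - √(M ^ 2 + ‖(M * (√(1 - ‖u‖ ^ 2))⁻¹) • u‖ ^ 2) = 0 := by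
  have h1 : 0 < 1 - ‖u‖ ^ 2 := by nlinarith [norm_nonneg u]
  have hs : 0 < √(1 - ‖u‖ ^ 2) := Real.sqrt_pos.mpr h1
  have hγ : 0 < (√(1 - ‖u‖ ^ 2))⁻¹ := inv_pos.mpr hs
  have hsq : (√(1 - ‖u‖ ^ 2)) ^ 2 = 1 - ‖u‖ ^ 2 := Real.sq_sqrt h1.le
  have hγ2 : ((√(1 - ‖u‖ ^ 2))⁻¹) ^ 2 * (1 - ‖u‖ ^ 2) = 1 := by
    rw [inv_pow, hsq, inv_mul_cancel₀ h1.ne']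
  have hx : 0 ≤ M * (√(1 - ‖u‖ ^ 2))⁻¹ := (mul_pos hM hγ).le
  have hns : ‖(M * (√(1 - ‖u‖ ^ 2))⁻¹) • u‖ = M * (√(1 - ‖u‖ ^ 2))⁻¹ * ‖u‖ := by
    rw [norm_smul, Real.norm_eq_abs, abs_of_nonneg hx]
  have heq : M ^ 2 + ‖(M * (√(1 - ‖u‖ ^ 2))⁻¹) • u‖ ^ 2 = (M * (√(1 - ‖u‖ ^ 2))⁻¹) ^ 2 := by
    rw [hns]
    have : M ^ 2 = (M * (√(1 - ‖u‖ ^ 2))⁻¹) ^ 2 * (1 - ‖u‖ ^ 2) := by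
      calc M ^ 2 = M ^ 2 * (((√(1 - ‖u‖ ^ 2))⁻¹) ^ 2 * (1 - ‖u‖ ^ 2)) := by rw [hγ2, mul_one]
        _ = (M * (√(1 - ‖u‖ ^ 2))⁻¹) ^ 2 * (1 - ‖u‖ ^ 2) := by ring
    rw [this]; ring
  rw [heq, Real.sqrt_sq hx, sub_self]

/-- **From a linear lower bound on a grid to all times**: `α·(nh) − β ≤ L·f(T + nh)` for all `n : ℕ` and
`f s ≤ f t + 2(t − s)` for `T ≤ s ≤ t` give eventually `f(t) ≥ (α/(4L))·t`. [folklore] -/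
theorem eventually_linear_of_grid {f : ℝ → ℝ} {T h α β L : ℝ} (hh : 0 < h) (hα : 0 < α) (hL : 0 < L) (hT : 0 ≤ T)
    (hgrid : ∀ n : ℕ, α * (n * h) - β ≤ L * f (T + n * h))
    (hlip : ∀ s t, T ≤ s → s ≤ t → f s ≤ f t + 2 * (t - s)) :
    ∀ᶠ t in atTop, α / (4 * L) * t ≤ f t := by
  set K : ℝ := α * (T + h) + |β| + 2 * L * h with hK
  have hK0 : 0 ≤ K := by positivity
  filter_upwards [eventually_ge_atTop (T + h), eventually_ge_atTop (4 * K / (3 * α))] with t ht htK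
  have htT : 0 ≤ (t - T) / h := div_nonneg (by linarith) hh.le
  set n : ℕ := ⌊(t - T) / h⌋₊ with hn
  have hn1 : (n : ℝ) * h ≤ t - T := by
    have h1 : (n : ℝ) ≤ (t - T) / h := Nat.floor_le htT
    rwa [le_div_iff₀ hh] at h1
  have hn2 : t - T < ((n : ℝ) + 1) * h := by
    have h1 : (t - T) / h < (n : ℝ) + 1 := Nat.lt_floor_add_one _
    rwa [div_lt_iff₀ hh] at h1
  have hg := hgrid n
  have hl := hlip (T + n * h) t (le_add_of_nonneg_right (by positivity)) (by linarith)
  have h1 : α * (t - T - h) ≤ α * (n * h) := mul_le_mul_of_nonneg_left (by nlinarith) hα.le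
  have h2 : L * f (T + n * h) ≤ L * (f t + 2 * h) := mul_le_mul_of_nonneg_left (by nlinarith) hL.le
  have h3 : α * t - K ≤ L * f t := by
    rw [hK]
    nlinarith [le_abs_self β]
  have h4 : K ≤ 3 * α / 4 * t := by
    have := (div_le_iff₀ (by positivity : (0:ℝ) < 3 * α)).mp htK
    linarith
  have h5 : α / (4 * L) * t * L = α / 4 * t := by field_simp
  have h6 : α / (4 * L) * t ≤ f t ↔ α / (4 * L) * t * L ≤ f t * L := (mul_le_mul_iff_of_pos_right hL).symm
  rw [h6, h5]
  nlinarith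

/-- **COLD OR LINEARLY EXTENDED FOREVER.** Under the hypotheses of `stub_pairwiseDichotomy`: either all velocities converge to
ONE vector, or there is `b > 0` with two bodies at distance `≥ b·t` at EVERY late time. (`K → K∞ ≥ 0` by `tendsto_charges_univ`;
`K∞ = 0`: `tendsto_velocity_of_internalEnergy_tendsto_zero'`; `K∞ > 0`: `internalEnergy_le'` gives `σ₂ ≥ K∞/(2C_K)` late, and
`virial_inequality_of_windows` for the trivially gapped root `univ` gives `(cq/2)·nh − A·diam T ≤ (A + CJ)·diam(T + nh)` on the
grid; the diameter is `2`-Lipschitz by `exists_forall_norm_sub_le_sub_of_slaved'`.) [folklore] -/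
theorem cold_or_extended (M : Fin N → ℝ) (ξ v : Fin N → ℝ → E3) (κ : ℝ)
    (P : ℝ → E3 → ℝ → Fin 4 → ℝ) (hM : ∀ i, 0 < M i) (hκ0 : 0 < κ) (hκ1 : κ < 1)
    (hξ : ∀ i, ContDiff ℝ ((⊤ : ℕ∞) : WithTop ℕ∞) (ξ i))
    (hcone : ∀ i, ∀ᶠ t in atTop, ‖ξ i t‖ ≤ κ ^ 2 * t)
    (hsep : ∀ i j, i ≠ j → Tendsto (fun t ↦ ‖ξ i t - ξ j t‖) atTop atTop) (hvc : ∀ i, Continuous (v i))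
    (hk : ∃ k : ℝ, 0 ≤ k ∧ k < 1 ∧ ∀ i t, ‖v i t‖ ≤ k)
    (hslave : ∀ i, Tendsto (fun t ↦ deriv (ξ i) t - v i t) atTop (𝓝 0))
    (hWL : ∀ ρ : ℝ → ℝ, Tendsto ρ atTop atTop → ∀ δ : ℝ, 0 < δ → δ < 1 → ∃ (C T : ℝ),
      ∀ (t₁ t₂ : ℝ) (c : ℝ → E3) (R : ℝ → ℝ), T ≤ t₁ → t₁ ≤ t₂ →
      (∀ s ∈ Set.Icc t₁ t₂, ∀ s' ∈ Set.Icc t₁ t₂, ‖c s - c s'‖ ≤ 2 * |s - s'| ∧ |R s - R s'| ≤ 2 * |s - s'|) →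
      (∀ s ∈ Set.Icc t₁ t₂, ρ s ≤ δ * R s ∧ ‖c s‖ + R s ≤ (κ + κ ^ 2) / 2 * s ∧
        ∀ j, ‖ξ j s - c s‖ ≤ (1 - δ) * R s ∨ (1 + δ) * R s ≤ ‖ξ j s - c s‖) →
      ∀ μ : Fin 4, |P t₂ (c t₂) (R t₂) μ - P t₁ (c t₁) (R t₁) μ| ≤ C * ∫ s in t₁..t₂, (R s ^ (3 / 2 : ℝ))⁻¹)
    (hID : ∀ ρ : ℝ → ℝ, Tendsto ρ atTop atTop → ∀ δ : ℝ, 0 < δ → δ < 1 → ∃ (T : ℝ) (ζ : ℝ → ℝ),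
      Tendsto ζ atTop (𝓝 0) ∧ ∀ (t : ℝ) (c : E3) (R : ℝ) (A : Finset (Fin N)), T ≤ t → ρ t ≤ δ * R →
      ‖c‖ + R ≤ (κ + κ ^ 2) / 2 * t → (∀ j, ‖ξ j t - c‖ ≤ (1 - δ) * R ∨ (1 + δ) * R ≤ ‖ξ j t - c‖) →
      (∀ j, j ∈ A ↔ ‖ξ j t - c‖ ≤ (1 - δ) * R) →
      |P t c R 0 - ∑ j ∈ A, M j * (√(1 - ‖v j t‖ ^ 2))⁻¹| ≤ ζ t ∧
      ∀ k : Fin 3, |P t c R k.succ - ∑ j ∈ A, M j * (√(1 - ‖v j t‖ ^ 2))⁻¹ * v j t k| ≤ ζ t) :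
    (∃ V : E3, ∀ j, Tendsto (v j) atTop (𝓝 V)) ∨
      ∃ b : ℝ, 0 < b ∧ ∀ᶠ t in atTop, ∃ i j : Fin N, b * t ≤ ‖ξ i t - ξ j t‖ := by
  classical
  obtain ⟨k, hk0, hk1, hvk⟩ := id hk
  have hk2 : 0 < 1 - k ^ 2 := by nlinarith
  have hv1 : ∀ i t, ‖v i t‖ < 1 := fun i t ↦ (hvk i t).trans_lt hk1
  rcases Nat.lt_or_ge N 2 with hN | hN
  · left
    rcases Nat.lt_or_ge N 1 with hN0 | hN1
    · have : N = 0 := by omega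
      subst this
      exact ⟨0, fun j ↦ j.elim0⟩
    · have hN1' : N = 1 := by omega
      subst hN1'
      obtain ⟨Einf, Pinf, -, hP⟩ := tendsto_charges_univ M ξ v κ P hκ0 hκ1 hcone hWL hID
      refine ⟨(√((∑ i : Fin 1, M i) ^ 2 + ‖Pinf‖ ^ 2))⁻¹ • Pinf, fun j ↦ ?_⟩
      refine tendsto_velocity_of_internalEnergy_tendsto_zero' (univ : Finset (Fin 1)) M v (fun i _ ↦ hM i) hk0 hk1
        (fun i _ t ↦ hvk i t) hP ?_ (mem_univ j)
      have hz : (fun t ↦ ∑ i : Fin 1, M i * (√(1 - ‖v i t‖ ^ 2))⁻¹ -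
          √((∑ i : Fin 1, M i) ^ 2 + ‖∑ i : Fin 1, (M i * (√(1 - ‖v i t‖ ^ 2))⁻¹) • v i t‖ ^ 2)) = fun _ ↦ 0 := by
        funext t
        simp only [Finset.univ_unique, Fin.default_eq_zero, Finset.sum_singleton]
        exact internalEnergy_singleton (hM 0) (hv1 0 t)
      rw [hz]
      exact tendsto_const_nhds
  have hne : (univ : Finset (Fin N)).Nonempty := Finset.univ_nonempty_iff.mpr ⟨⟨0, by omega⟩⟩
  obtain ⟨x₀, hx₀⟩ := hne
  have h2 : 2 ≤ (univ : Finset (Fin N)).card := by simpa using hN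
  have hMK : 0 < ∑ i, M i := Finset.sum_pos (fun i _ ↦ hM i) ⟨x₀, hx₀⟩
  have hΓ : ∀ i t, (√(1 - ‖v i t‖ ^ 2))⁻¹ ≤ (√(1 - k ^ 2))⁻¹ := fun i t ↦ by
    refine inv_anti₀ (Real.sqrt_pos.mpr hk2) (Real.sqrt_le_sqrt ?_)
    nlinarith [hvk i t, norm_nonneg (v i t)]
  obtain ⟨Einf, Pinf, hE, hP⟩ := tendsto_charges_univ M ξ v κ P hκ0 hκ1 hcone hWL hID
  set Kinf : ℝ := Einf - √((∑ i, M i) ^ 2 + ‖Pinf‖ ^ 2) with hKinf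
  have hKt : Tendsto (fun t ↦ ∑ j, M j * (√(1 - ‖v j t‖ ^ 2))⁻¹ -
      √((∑ i, M i) ^ 2 + ‖∑ i, (M i * (√(1 - ‖v i t‖ ^ 2))⁻¹) • v i t‖ ^ 2)) atTop (𝓝 Kinf) :=
    hE.sub (((hP.norm.pow 2).const_add _).sqrt)
  have hKinf0 : 0 ≤ Kinf :=
    ge_of_tendsto' hKt fun t ↦ internalEnergy_nonneg univ M (fun j ↦ v j t) (fun i _ ↦ hM i) ⟨x₀, hx₀⟩
      fun i _ ↦ hv1 i t
  rcases hKinf0.eq_or_lt with hK0 | hKpos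
  · -- COLD: `K∞ = 0`
    left
    rw [← hK0] at hKt
    exact ⟨(√((∑ i, M i) ^ 2 + ‖Pinf‖ ^ 2))⁻¹ • Pinf, fun j ↦
      tendsto_velocity_of_internalEnergy_tendsto_zero' univ M v (fun i _ ↦ hM i) hk0 hk1 (fun i _ t ↦ hvk i t) hP hKt
        (mem_univ j)⟩
  right
  have hroot : ∀ᶠ t in atTop, ∃ D G : ℝ, (∀ x ∈ (univ : Finset (Fin N)), ∀ y ∈ (univ : Finset (Fin N)),
      ‖ξ x t - ξ y t‖ ≤ D) ∧ (∀ x ∈ (univ : Finset (Fin N)), ∀ z ∈ univ \ univ, G ≤ ‖ξ x t - ξ z t‖) ∧ 1 * D < G := by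
    refine Eventually.of_forall fun t ↦ ?_
    have hne2 : ((univ : Finset (Fin N)) ×ˢ (univ : Finset (Fin N))).Nonempty := ⟨(x₀, x₀), by simp⟩
    refine ⟨((univ : Finset (Fin N)) ×ˢ univ).sup' hne2 (fun p ↦ ‖ξ p.1 t - ξ p.2 t‖),
      ((univ : Finset (Fin N)) ×ˢ univ).sup' hne2 (fun p ↦ ‖ξ p.1 t - ξ p.2 t‖) + 1, fun x _ y _ ↦ ?_,
      fun x _ z hz ↦ ((Finset.mem_sdiff.mp hz).2 (Finset.mem_univ z)).elim, by rw [one_mul]; exact lt_add_one _⟩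
    exact Finset.le_sup' (fun p : Fin N × Fin N ↦ ‖ξ p.1 t - ξ p.2 t‖) (b := (x, y)) (by simp)
  obtain ⟨h, CJ, T₂, ε, hh, hCJ, hεa, hεt, hvir⟩ :=
    virial_inequality_of_windows M ξ v κ P hM hκ0 hκ1 hξ hcone hsep hvc hk hslave hWL hID univ h2 hroot
  clear hWL hID hroot hsep hcone
  have hne2 : ((univ : Finset (Fin N)) ×ˢ (univ : Finset (Fin N))).Nonempty := ⟨(x₀, x₀), by simp⟩
  obtain ⟨diam, hdiam⟩ : ∃ d : ℝ → ℝ, ∀ t, d t = ((univ : Finset (Fin N)) ×ˢ univ).sup' hne2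
      (fun p ↦ ‖ξ p.1 t - ξ p.2 t‖) := ⟨_, fun _ ↦ rfl⟩
  have hdle : ∀ t, ∀ x y : Fin N, ‖ξ x t - ξ y t‖ ≤ diam t := fun t x y ↦ by
    rw [hdiam]
    exact Finset.le_sup' (fun p : Fin N × Fin N ↦ ‖ξ p.1 t - ξ p.2 t‖) (b := (x, y)) (by simp)
  have hd0 : ∀ t, 0 ≤ diam t := fun t ↦ (norm_nonneg _).trans (hdle t x₀ x₀)
  have hdex : ∀ t, ∃ i j : Fin N, diam t = ‖ξ i t - ξ j t‖ := fun t ↦ by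
    obtain ⟨p, -, hp⟩ := Finset.exists_mem_eq_sup' hne2 (fun p : Fin N × Fin N ↦ ‖ξ p.1 t - ξ p.2 t‖)
    exact ⟨p.1, p.2, by rw [hdiam, hp]⟩
  obtain ⟨A, hAdef⟩ : ∃ A : ℝ, A = max 1 ((∑ i, M i) * (√(1 - k ^ 2))⁻¹) := ⟨_, rfl⟩
  have hA1 : 1 ≤ A := hAdef ▸ le_max_left _ _
  have hAΓ : (∑ i, M i) * (√(1 - k ^ 2))⁻¹ ≤ A := hAdef ▸ le_max_right _ _
  have hA0 : 0 < A := one_pos.trans_le hA1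
  obtain ⟨G, hGdef⟩ : ∃ G : ℝ → ℝ, ∀ t, G t = ∑ j, inner ℝ ((M j * (√(1 - ‖v j t‖ ^ 2))⁻¹) • v j t)
      (ξ j t - (∑ l, M l)⁻¹ • ∑ l, M l • ξ l t) := ⟨_, fun _ ↦ rfl⟩
  obtain ⟨σ₂, hσdef⟩ : ∃ σ₂ : ℝ → ℝ, ∀ t, σ₂ t = ∑ j, ∑ l, M j * M l * ‖v j t - v l t‖ ^ 2 :=
    ⟨_, fun _ ↦ rfl⟩
  have hσc : Continuous σ₂ := by
    rw [show σ₂ = fun t ↦ ∑ j, ∑ l, M j * M l * ‖v j t - v l t‖ ^ 2 from funext hσdef]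
    exact continuous_finsetSum _ fun j _ ↦ continuous_finsetSum _ fun l _ ↦
      continuous_const.mul (((hvc j).sub (hvc l)).norm.pow 2)
  have hGle : ∀ t, |G t| ≤ A * diam t := by
    intro t
    rw [hGdef]
    refine (Finset.abs_sum_le_sum_abs _ _).trans ?_
    have hterm : ∀ j ∈ (univ : Finset (Fin N)), |inner ℝ ((M j * (√(1 - ‖v j t‖ ^ 2))⁻¹) • v j t)
        (ξ j t - (∑ l, M l)⁻¹ • ∑ l, M l • ξ l t)| ≤ M j * (√(1 - k ^ 2))⁻¹ * diam t := by
      intro j _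
      refine (abs_real_inner_le_norm _ _).trans ?_
      have hγ0 : 0 < (√(1 - ‖v j t‖ ^ 2))⁻¹ :=
        inv_pos.mpr (Real.sqrt_pos.mpr (by nlinarith only [hv1 j t, norm_nonneg (v j t)]))
      have h1 : ‖(M j * (√(1 - ‖v j t‖ ^ 2))⁻¹) • v j t‖ ≤ M j * (√(1 - k ^ 2))⁻¹ := by
        rw [norm_smul, Real.norm_eq_abs, abs_of_pos (mul_pos (hM j) hγ0)]
        calc M j * (√(1 - ‖v j t‖ ^ 2))⁻¹ * ‖v j t‖ ≤ M j * (√(1 - ‖v j t‖ ^ 2))⁻¹ * 1 :=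
              mul_le_mul_of_nonneg_left (hv1 j t).le (mul_pos (hM j) hγ0).le
          _ ≤ M j * (√(1 - k ^ 2))⁻¹ := by
              rw [mul_one]; exact mul_le_mul_of_nonneg_left (hΓ j t) (hM j).le
      have h2 : ‖ξ j t - (∑ l, M l)⁻¹ • ∑ l, M l • ξ l t‖ ≤ diam t :=
        norm_sub_centre_le (ξ := fun i ↦ ξ i t) (M := M) (S := univ) (A := univ) hM subset_rfl ⟨x₀, hx₀⟩
          (mem_univ j) (fun x _ y _ ↦ hdle t x y)
      exact mul_le_mul h1 h2 (norm_nonneg _) (mul_pos (hM j) (inv_pos.mpr (Real.sqrt_pos.mpr hk2))).le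
    refine (Finset.sum_le_sum hterm).trans ?_
    rw [← Finset.sum_mul, ← Finset.sum_mul]
    exact mul_le_mul_of_nonneg_right hAΓ (hd0 t)
  set CK : ℝ := 2 * ((√(1 - k ^ 2))⁻¹) ^ 8 / ∑ i, M i with hCKdef
  have hCK0 : 0 < CK := by positivity
  set c : ℝ := (2 * ∑ i, M i)⁻¹ with hcdef
  have hc0 : 0 < c := by positivity
  set q : ℝ := Kinf / (2 * CK) with hqdef
  have hq0 : 0 < q := by positivity
  have hev_σ : ∀ᶠ t in atTop, q ≤ σ₂ t := by
    have hK2 : ∀ᶠ t in atTop, Kinf / 2 < ∑ j, M j * (√(1 - ‖v j t‖ ^ 2))⁻¹ -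
        √((∑ i, M i) ^ 2 + ‖∑ i, (M i * (√(1 - ‖v i t‖ ^ 2))⁻¹) • v i t‖ ^ 2) :=
      hKt.eventually (lt_mem_nhds (by linarith only [hKpos]))
    filter_upwards [hK2] with t ht
    have hle : ∑ j, M j * (√(1 - ‖v j t‖ ^ 2))⁻¹ -
        √((∑ i, M i) ^ 2 + ‖∑ i, (M i * (√(1 - ‖v i t‖ ^ 2))⁻¹) • v i t‖ ^ 2) ≤ CK * σ₂ t := by
      rw [hσdef]
      exact internalEnergy_le' univ M (fun j ↦ v j t) (fun i _ ↦ hM i) hk1 (fun i _ ↦ hvk i t) ⟨x₀, hx₀⟩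
    rw [hqdef, div_le_iff₀ (by positivity)]
    linarith only [ht, hle]
  have hev_ε : ∀ᶠ t in atTop, ε t ≤ c * q / 2 :=
    (hεt.eventually (gt_mem_nhds (show (0:ℝ) < c * q / 2 by positivity))).mono fun t ht ↦ ht.le
  obtain ⟨T_M, hTM⟩ := exists_forall_norm_sub_le_sub_of_slaved' (ξ := ξ) (v := v)
    (fun i ↦ (hξ i).differentiable (by simp)) hk hslave
  obtain ⟨T₃, hT₃⟩ := eventually_atTop.mp (hev_σ.and hev_ε)
  set T : ℝ := max (max (max T₂ T₃) T_M) 1 with hTdef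
  have hT2 : T₂ ≤ T := ((le_max_left _ _).trans (le_max_left _ _)).trans (le_max_left _ _)
  have hT3 : T₃ ≤ T := ((le_max_right _ _).trans (le_max_left _ _)).trans (le_max_left _ _)
  have hTM' : T_M ≤ T := (le_max_right _ _).trans (le_max_left _ _)
  have hT1 : 1 ≤ T := le_max_right _ _
  have hTpos : 0 < T := one_pos.trans_le hT1
  have hgrid : ∀ n : ℕ, c * q / 2 * (n * h) - A * diam T ≤ (A + CJ) * diam (T + n * h) := by
    intro n
    have hv := hvir T hT2 n (diam (T + n * h)) (hd0 _) (fun x _ y _ ↦ hdle _ x y)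
    rw [← hGdef (T + n * h), ← hGdef T] at hv
    have hσ : (∫ s in T..(T + n * h), ∑ j, ∑ l, M j * M l * ‖v j s - v l s‖ ^ 2) =
        ∫ s in T..(T + n * h), σ₂ s := by simp only [hσdef]
    rw [hσ] at hv
    have hnh : 0 ≤ (n : ℝ) * h := by positivity
    have hle : T ≤ T + n * h := le_add_of_nonneg_right hnh
    have hσint : q * (n * h) ≤ ∫ s in T..(T + n * h), σ₂ s := by
      have h1 : ∫ _ in T..(T + n * h), q = q * (n * h) := by
        rw [intervalIntegral.integral_const, smul_eq_mul]; ring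
      rw [← h1]
      refine intervalIntegral.integral_mono_on hle (by simp) (hσc.intervalIntegrable _ _) fun s hs ↦ ?_
      exact (hT₃ s (hT3.trans hs.1)).1
    have hεint : (∫ s in T..(T + n * h), ε s) ≤ c * q / 2 * (n * h) := by
      have h1 : ∫ _ in T..(T + n * h), c * q / 2 = c * q / 2 * (n * h) := by
        rw [intervalIntegral.integral_const, smul_eq_mul]; ring
      rw [← h1]
      refine intervalIntegral.integral_mono_on hle hεa.intervalIntegrable (by simp) fun s hs ↦ ?_
      exact (hT₃ s (hT3.trans hs.1)).2
    have hG1 := (abs_le.mp (hGle (T + n * h))).2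
    have hG2 := (abs_le.mp (hGle T)).1
    have hcσ : c * (q * (n * h)) ≤ c * ∫ s in T..(T + n * h), σ₂ s := mul_le_mul_of_nonneg_left hσint hc0.le
    linarith only [hv, hcσ, hεint, hG1, hG2]
  have hACJ : 0 < A + CJ := by linarith only [hA0, hCJ]
  have hlip : ∀ s t, T ≤ s → s ≤ t → diam s ≤ diam t + 2 * (t - s) := by
    intro s t hs hst
    have hmove : |diam s - diam t| ≤ 2 * (t - s) := by
      rw [hdiam, hdiam]
      refine abs_sup'_dist_sub_le hne2 (fun i ↦ ξ i s) (fun i ↦ ξ i t) fun p _ ↦ ⟨?_, ?_⟩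
      · rw [norm_sub_rev]; exact hTM p.1 _ _ (hTM'.trans hs) hst
      · rw [norm_sub_rev]; exact hTM p.2 _ _ (hTM'.trans hs) hst
    linarith only [(abs_le.mp hmove).2]
  have hev := eventually_linear_of_grid (f := diam) hh (show 0 < c * q / 2 by positivity) hACJ hTpos.le hgrid hlip
  refine ⟨c * q / 2 / (4 * (A + CJ)), by positivity, ?_⟩
  filter_upwards [hev] with t ht
  obtain ⟨i, j, hij⟩ := hdex t
  exact ⟨i, j, hij ▸ ht⟩

/-- Registered one-line helper of this file: one body has no internal energy. [folklore] -/
theorem internalEnergy_singleton' : open Literature.Geometry.Lorentzian in ∀ {M : ℝ}, 0 < M → ∀ {u : E3}, ‖u‖ < 1 → M * (√(1 - ‖u‖ ^ 2))⁻¹ - √(M ^ 2 + ‖(M * (√(1 - ‖u‖ ^ 2))⁻¹) • u‖ ^ 2) = 0 :=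
  fun hM _ hu ↦ internalEnergy_singleton hM hu

end Summit.FinalStateConjecture.FinalStateConjecture.Theorems.SublinearIsFree.Virial

end
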